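import Summits.CriticalPhenomena.CardyFormulaZ2.Theorems.CardyBoundaryCoulombGasHalfPlaneMarkDensityLawWiredCardy
import Summits.CriticalPhenomena.CardyFormulaZ2.Theorems.CardyBoundaryCoulombGasHalfPlaneMarkDensityLawNoFreeConstant

/-!
# Lead's skeleton (c12-0), cycle 10: **THE TARGET OF ROUTE CardyTotalPositivity IN TERMS OF THE JOINT LIMITS**
# (crux `HalfPlaneMarkDensityLaw`, line `Sketch`; bridge stmt-5661 ↔ stmt-9321)

`HalfPlaneWiredCardy` (stmt-CriticalPhenomena-9321, target of route CardyTotalPositivity; implied by crux 5, `…WiredCardy`) says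
the wired kernel `P_n(σ,x) → F(x/(x+σ))`.  With W1 (wired kernel along `θ` → `W_G(σ,x)`) and T1 (three-arc limit
`G₃(a,b,c) = W_G(c−b, b−a)`) of `Lines/Sketch_WiredDual.lean` / `Lines/Sketch_ThreeArcDual.lean` and precompactness (c2-0):
**`HalfPlaneWiredCardy ⟺ for every joint subsequential limit `G`, `lim_{y→∞} G(a,b,c,y) = F((b−a)/(c−a))`** — stmt-9321 is the
identification of the THREE-ARC limits, stmt-5661 that of the four-arc `x`-shape (`halfPlaneMarkDensityLaw_iff_shape`).
-/

noncomputable section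

namespace Summit.CriticalPhenomena.CardyFormulaZ2.Cruxes.HalfPlaneMarkDensityLaw.SketchLine

open Literature.Probability.Percolation Literature.Probability.LatticeModels
open MeasureTheory Filter Set
open scoped Topology
open Summit.CriticalPhenomena.CardyFormulaZ2.Theorems.HalfPlaneMarkDensityLaw.Negative

namespace WiredDual

/-- STUB C10: **`HalfPlaneWiredCardy ⟺` the three-arc limits of every joint subsequential limit are `F((b−a)/(c−a))`.** [folklore] -/
theorem halfPlaneWiredCardy_iff_threeArc :
    (Summit.CriticalPhenomena.CardyFormulaZ2.Theses.CardyTotalPositivity.HalfPlaneWiredCardy ↔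
      ∀ θ : ℕ → ℕ, StrictMono θ → ∀ G : ℝ → ℝ → ℝ → ℝ → ℝ,
        (∀ a b c y : ℝ, a < b → b < c → c < y →
        Tendsto (fun n ↦ μ.real (openCrossing halfPlane (arcA a b (θ n))
          (rowIcc ⌊c * (θ n : ℕ)⌋ ⌊y * (θ n : ℕ)⌋))) atTop (𝓝 (G a b c y))) →
        ∀ a b c : ℝ, a < b → b < c →
          Tendsto (fun y : ℝ ↦ G a b c y) atTop (𝓝 (Literature.Probability.RandomPlanarGeometry.cardyFunction ((b - a) / (c - a))))) := by
  sorry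

/-- STUB C10' (glue): W1, T1 and precompactness give C10. [folklore] -/
theorem halfPlaneWiredCardy_iff_threeArc_of :
    (∀ {θ : ℕ → ℕ} {G : ℝ → ℝ → ℝ → ℝ → ℝ}, (∀ a b c y : ℝ, a < b → b < c → c < y → Tendsto (fun n ↦ μ.real (openCrossing halfPlane (arcA a b (θ n)) (rowIcc ⌊c * (θ n : ℕ)⌋ ⌊y * (θ n : ℕ)⌋))) atTop (𝓝 (G a b c y))) → StrictMono θ → ∀ σ x : ℝ, 0 < σ → 0 < x → ∃ W : ℝ, Tendsto (fun M : ℕ ↦ G (-(M : ℝ)) (-σ) ((M : ℝ)⁻¹) x) atTop (𝓝 W) ∧ Tendsto (fun n ↦ μ.real (openCrossing halfPlane {v : Site 2 | v 1 = 0 ∧ v 0 ≤ -⌊σ * (θ n : ℕ)⌋} {v : Site 2 | v 1 = 0 ∧ 1 ≤ v 0 ∧ v 0 ≤ ⌊x * (θ n : ℕ)⌋})) atTop (𝓝 W)) →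
    (∀ {θ : ℕ → ℕ} {G : ℝ → ℝ → ℝ → ℝ → ℝ}, (∀ a b c y : ℝ, a < b → b < c → c < y → Tendsto (fun n ↦ μ.real (openCrossing halfPlane (arcA a b (θ n)) (rowIcc ⌊c * (θ n : ℕ)⌋ ⌊y * (θ n : ℕ)⌋))) atTop (𝓝 (G a b c y))) → StrictMono θ → ∀ a b c : ℝ, a < b → b < c → ∃ L : ℝ, Tendsto (fun y : ℝ ↦ G a b c y) atTop (𝓝 L) ∧ Tendsto (fun M : ℕ ↦ G (-(M : ℝ)) (-(c - b)) ((M : ℝ)⁻¹) (b - a)) atTop (𝓝 L)) →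
    (Summit.CriticalPhenomena.CardyFormulaZ2.Theses.CardyTotalPositivity.HalfPlaneWiredCardy ↔
      ∀ θ : ℕ → ℕ, StrictMono θ → ∀ G : ℝ → ℝ → ℝ → ℝ → ℝ,
        (∀ a b c y : ℝ, a < b → b < c → c < y →
        Tendsto (fun n ↦ μ.real (openCrossing halfPlane (arcA a b (θ n))
          (rowIcc ⌊c * (θ n : ℕ)⌋ ⌊y * (θ n : ℕ)⌋))) atTop (𝓝 (G a b c y))) →
        ∀ a b c : ℝ, a < b → b < c →
          Tendsto (fun y : ℝ ↦ G a b c y) atTop (𝓝 (Literature.Probability.RandomPlanarGeometry.cardyFunction ((b - a) / (c - a))))) := by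
  sorry

end WiredDual

end Summit.CriticalPhenomena.CardyFormulaZ2.Cruxes.HalfPlaneMarkDensityLaw.SketchLine
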